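import Mathlib
import Summits.Ventures.HodgeRepro.Tier4.Common.AdelicRTF
import Summits.Ventures.HodgeRepro.Tier4.Common.MixedPlaneCusp
import Summits.Ventures.HodgeRepro.Tier4.Line4.ThetaEquivariance
import Summits.Ventures.HodgeRepro.Tier4.Line4.GeometricSide

/-!
# Tier4/Line4/OrbitalUnfold — Theorems B, C, D of proofs/t4/L4/W5-GeometricSide.md: the UNFOLDED orbital integral
over `T(𝔸) × T′(𝔸)` is the `T(k) × T′(k)`-sum of the folded ones (Mathlib's `IsFundamentalDomain.integral_eq_tsum''`
twice), a regular orbit sums to that double sum, the `G(k)`-sum groups by any labelling of the orbits, and W5's shape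
«only one orbit contributes ⇒ `Jc f = O_{γ₀}(f)`» — every convergence hypothesis displayed

Blind re-derivation cell `pub-hodge-repro`, Tier 4 «prove the step» (README §9–§10), seat t4-L4-p2 (gen 2; lead g385
cut S13064 (5): W4 / W5).  Tree path `lean/Summits/Ventures/HodgeRepro/Tier4/Line4/OrbitalUnfold.lean`.  Imports
`Line4/GeometricSide` (p675591: `innerFn`, `innerInt`, `orbitalc_eq_integral`, Theorem A `Jc_eq_tsum_orbitalc`),
`Common/MixedPlaneCusp` (`RTFData.IsHaar`) and t4-L4-p1's `Line4/ThetaEquivariance` (`countable_rationalOf`).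

THE STATEMENTS.  **B** `orbitalFull_eq_tsum_tsum`: for `γ₀ ∈ G(𝔸)`, `O_{γ₀}(f) := ∫_{T(𝔸)} χ(t) ∫_{T′(𝔸)} conj χ′(t′)
f(t⁻¹ γ₀ t′) dμ_{T′} dμ_T` (`orbitalFull`) equals `∑' δ ∈ T(k), ∑' δ′ ∈ T′(k), orbitalc (δ⁻¹ γ₀ δ′) f` — Jacquet's
«∫∫ over `A(F)\A(𝔸) × B(F)\B(𝔸)` of the sum over the orbit» read backwards; INPUTS `R.IsHaar` (left invariance: the
rational points act measure-preservingly, the fundamental domains unfold), `MeasurableMul` on the tori, and (B1)–(B4).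
**C** `tsum_orbit_eq_tsum_tsum`: for `γ₀ ∈ G(k)` with INJECTIVE orbit map `(δ, δ′) ↦ δ⁻¹ γ₀ δ′` («regular»: trivial
stabiliser in `T(k) × T′(k)` — FALSE for the identity, whose stabiliser is the diagonal of `(T ∩ T′)(k) ⊇ Z(k)`), the
sum of the folded orbital integrals over the orbit is the double sum of B.  **D** `tsum_orbitalc_eq_tsum_fibers`: the
`G(k)`-sum of Theorem A groups by the fibres of ANY labelling `G(k) → ι` (the orbit labelling is the intended one).
ASSEMBLY `orbit_term_eq_orbitalFull` (A + D + C + B) and `Jc_eq_orbitalFull_of_isolated`: if every orbit term but one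
vanishes (`hiso` — the arithmetic «only the identity double coset contributes at deep level», Feigon–Whitehouse 2009
p. 5 for one torus, UNPRINTED for two), `Jc f = O_{γ₀}(f)`: W5 becomes the non-vanishing of ONE unfolded orbital
integral.  Nothing asserts any hypothesis; nothing here is about the wall's truth.  HC_CM is NOT proved by anyone in
this repository.
-/

set_option autoImplicit false

noncomputable section

namespace Summit.Ventures.HodgeRepro.Tier4.Line4

open Summit.Ventures.HodgeRepro.Tier4.Common MeasureTheory NumberField

section TheoremB

variable {k : Type} [Field k] [NumberField k] (W : PlaneData k)
  [MeasurableSpace (torusT W)] [MeasurableSpace (torusT' W)] (R : RTFData W)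

/-- The inner integral over the WHOLE torus `T′(𝔸)`: `∫_{T′(𝔸)} conj χ′(t′) f(t⁻¹ γ t′) dμ_{T′}`. -/
def innerFull (f : GA W → ℂ) (γ : GA W) (t : torusT W) : ℂ :=
  ∫ t', innerFn W R f γ t t' ∂(R.μT')

/-- **The unfolded orbital integral** `O_γ(f) = ∫_{T(𝔸)} χ(t) ∫_{T′(𝔸)} conj χ′(t′) f(t⁻¹ γ t′)` over the whole tori. -/
def orbitalFull (f : GA W → ℂ) (γ : GA W) : ℂ :=
  ∫ t, R.chi t * innerFull W R f γ t ∂(R.μT)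

/-- `χ` does not see a rational left translation. -/
theorem chi_rational_mul (δ : rationalOf W (torusT W)) (t : torusT W) :
    R.chi ((δ : torusT W) * t) = R.chi t := by
  rw [R.chi_mul, R.chi_rational _ δ.2, one_mul]

/-- `conj χ′` does not see a rational left translation. -/
theorem chi'conj_rational_mul (δ' : rationalOf W (torusT' W)) (t' : torusT' W) :
    R.chi'conj ((δ' : torusT' W) * t') = R.chi'conj t' := by
  unfold RTFData.chi'conj
  rw [R.chi'_mul, R.chi'_rational _ δ'.2, one_mul]

/-- The inner integrand of `δ⁻¹ γ₀ δ′` at `t` is the inner integrand of `γ₀` at `δ t`, left-translated by `δ′`. -/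
theorem innerFn_shift (f : GA W → ℂ) (γ₀ : GA W) (δ : rationalOf W (torusT W)) (δ' : rationalOf W (torusT' W))
    (t : torusT W) (t' : torusT' W) :
    innerFn W R f (((δ : torusT W) : GA W)⁻¹ * γ₀ * ((δ' : torusT' W) : GA W)) t t' =
      innerFn W R f γ₀ ((δ : torusT W) * t) ((δ' : torusT' W) * t') := by
  unfold innerFn
  rw [chi'conj_rational_mul]
  congr 2
  simp only [Subgroup.coe_mul, mul_inv_rev, mul_assoc]

/-- **Theorem B — the unfolded orbital integral is the `T(k) × T′(k)`-sum of the folded ones.**  DISPLAYED: `R.IsHaar`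
(left invariance), measurability of the multiplications, and the convergence hypotheses (B1)–(B4). -/
theorem orbitalFull_eq_tsum_tsum [MeasurableMul (torusT W)] [MeasurableMul (torusT' W)] (hR : R.IsHaar)
    (f : GA W → ℂ) (γ₀ : GA W)
    (hB1 : Integrable (fun t : torusT W => R.chi t * innerFull W R f γ₀ t) R.μT)
    (hB2 : ∀ s : torusT W, Integrable (innerFn W R f γ₀ s) R.μT')
    (hB3 : ∀ (δ : rationalOf W (torusT W)) (δ' : rationalOf W (torusT' W)),
      Integrable (fun t : torusT W =>
        R.chi t * innerInt W R f (((δ : torusT W) : GA W)⁻¹ * γ₀ * ((δ' : torusT' W) : GA W)) t)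
        (R.μT.restrict R.DT))
    (hB4 : ∀ δ : rationalOf W (torusT W), Summable (fun δ' : rationalOf W (torusT' W) =>
      ∫ t in R.DT, ‖R.chi t * innerInt W R f (((δ : torusT W) : GA W)⁻¹ * γ₀ * ((δ' : torusT' W) : GA W)) t‖
        ∂(R.μT))) :
    orbitalFull W R f γ₀ = ∑' δ : rationalOf W (torusT W), ∑' δ' : rationalOf W (torusT' W),
      R.orbitalc (((δ : torusT W) : GA W)⁻¹ * γ₀ * ((δ' : torusT' W) : GA W)) f := by
  haveI hcT : Countable (rationalOf W (torusT W)) := countable_rationalOf W _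
  haveI hcT' : Countable (rationalOf W (torusT' W)) := countable_rationalOf W _
  haveI : R.μT.IsMulLeftInvariant := hR.1.toIsMulLeftInvariant
  haveI : R.μT'.IsMulLeftInvariant := hR.2.1.toIsMulLeftInvariant
  haveI : SMulInvariantMeasure (torusT W) (torusT W) R.μT := ⟨fun c _ _ => measure_preimage_mul R.μT c _⟩
  haveI : SMulInvariantMeasure (torusT' W) (torusT' W) R.μT' := ⟨fun c _ _ => measure_preimage_mul R.μT' c _⟩
  haveI : SMulInvariantMeasure (rationalOf W (torusT W)) (torusT W) R.μT := Subgroup.smulInvariantMeasure _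
  haveI : SMulInvariantMeasure (rationalOf W (torusT' W)) (torusT' W) R.μT' := Subgroup.smulInvariantMeasure _
  haveI : MeasurableConstSMul (torusT W) (torusT W) := ⟨fun c => measurable_const_mul c⟩
  haveI : MeasurableConstSMul (torusT' W) (torusT' W) := ⟨fun c => measurable_const_mul c⟩
  haveI : MeasurableConstSMul (rationalOf W (torusT W)) (torusT W) := Subgroup.instMeasurableConstSMul _
  haveI : MeasurableConstSMul (rationalOf W (torusT' W)) (torusT' W) := Subgroup.instMeasurableConstSMul _
  -- the fundamental domains unfold the two integrals
  have houter := R.DT_fund.integral_eq_tsum'' (fun t : torusT W => R.chi t * innerFull W R f γ₀ t) hB1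
  have hinner : ∀ s : torusT W, innerFull W R f γ₀ s =
      ∑' δ' : rationalOf W (torusT' W), ∫ t' in R.DT', innerFn W R f γ₀ s ((δ' : torusT' W) * t') ∂(R.μT') := by
    intro s
    unfold innerFull
    rw [R.DT'_fund.integral_eq_tsum'' (innerFn W R f γ₀ s) (hB2 s)]
    rfl
  unfold orbitalFull
  rw [houter]
  refine tsum_congr fun δ => ?_
  -- the summand at `δ`
  have hsum : (fun t : torusT W => R.chi ((δ : torusT W) * t) * innerFull W R f γ₀ ((δ : torusT W) * t)) =
      fun t => ∑' δ' : rationalOf W (torusT' W),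
        R.chi t * innerInt W R f (((δ : torusT W) : GA W)⁻¹ * γ₀ * ((δ' : torusT' W) : GA W)) t := by
    funext t
    have hin : ∀ δ' : rationalOf W (torusT' W),
        ∫ t' in R.DT', innerFn W R f γ₀ ((δ : torusT W) * t) ((δ' : torusT' W) * t') ∂(R.μT') =
          innerInt W R f (((δ : torusT W) : GA W)⁻¹ * γ₀ * ((δ' : torusT' W) : GA W)) t := by
      intro δ'
      unfold innerInt
      refine integral_congr_ae (Filter.Eventually.of_forall fun t' => ?_)
      rw [innerFn_shift]
    rw [chi_rational_mul, hinner, tsum_mul_left]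
    congr 1
    exact tsum_congr hin
  show ∫ t in R.DT, R.chi ((δ : torusT W) * t) * innerFull W R f γ₀ ((δ : torusT W) * t) ∂(R.μT) = _
  rw [hsum, ← integral_tsum_of_summable_integral_norm (hB3 δ) (hB4 δ)]
  refine tsum_congr fun δ' => ?_
  refine (orbitalc_eq_integral W R f _ ?_ (hB3 δ δ')).symm
  intro t
  have hmp := measurePreserving_smul (δ' : torusT' W) R.μT'
  have h := (hmp.integrable_comp_of_integrable (hB2 ((δ : torusT W) * t))).restrict (s := R.DT')
  refine h.congr (Filter.Eventually.of_forall fun t' => ?_)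
  show innerFn W R f γ₀ ((δ : torusT W) * t) ((δ' : torusT' W) • t') = _
  rw [smul_eq_mul, innerFn_shift]

end TheoremB

section TheoremsCD

variable {k : Type} [Field k] [NumberField k] (W : PlaneData k)
  [MeasurableSpace (torusT W)] [MeasurableSpace (torusT' W)] (R : RTFData W)

/-- **The orbit map of `γ₀ ∈ G(k)`** under `T(k) × T′(k)`: `(δ, δ′) ↦ δ⁻¹ γ₀ δ′`, valued in `G(k)`. -/
def orbitMap (γ₀ : rationalPoints W) (p : rationalOf W (torusT W) × rationalOf W (torusT' W)) :
    rationalPoints W :=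
  ⟨((p.1 : torusT W) : GA W)⁻¹ * (γ₀ : GA W) * ((p.2 : torusT' W) : GA W), by
    exact (rationalPoints W).mul_mem ((rationalPoints W).mul_mem ((rationalPoints W).inv_mem p.1.2) γ₀.2) p.2.2⟩

omit [MeasurableSpace (torusT W)] [MeasurableSpace (torusT' W)] in
/-- The orbit map, unfolded. -/
theorem orbitMap_val (γ₀ : rationalPoints W) (p : rationalOf W (torusT W) × rationalOf W (torusT' W)) :
    ((orbitMap W γ₀ p : rationalPoints W) : GA W) =
      ((p.1 : torusT W) : GA W)⁻¹ * (γ₀ : GA W) * ((p.2 : torusT' W) : GA W) := rfl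

/-- **Theorem C — a REGULAR orbit (injective orbit map) sums to the double `T(k) × T′(k)`-sum**: the folded orbital
integrals over the orbit `{δ⁻¹ γ₀ δ′}` of `γ₀` add up to `∑' δ, ∑' δ′, orbitalc (δ⁻¹ γ₀ δ′) f` (DISPLAYED: the
summability of the double family; the injectivity = «the stabiliser of `γ₀` in `T(k) × T′(k)` is trivial», false for
the identity orbit, whose stabiliser is the diagonal of `(T ∩ T′)(k)`). -/
theorem tsum_orbit_eq_tsum_tsum (f : GA W → ℂ) (γ₀ : rationalPoints W) (hinj : Function.Injective (orbitMap W γ₀))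
    (hs : Summable (fun p : rationalOf W (torusT W) × rationalOf W (torusT' W) =>
      R.orbitalc ((orbitMap W γ₀ p : rationalPoints W) : GA W) f)) :
    (∑' γ : Set.range (orbitMap W γ₀), R.orbitalc ((γ : rationalPoints W) : GA W) f) =
      ∑' δ : rationalOf W (torusT W), ∑' δ' : rationalOf W (torusT' W),
        R.orbitalc (((δ : torusT W) : GA W)⁻¹ * (γ₀ : GA W) * ((δ' : torusT' W) : GA W)) f := by
  rw [tsum_range (fun γ : rationalPoints W => R.orbitalc (γ : GA W) f) hinj, hs.tsum_prod]
  exact tsum_congr fun δ => tsum_congr fun δ' => by simp only [orbitMap_val]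

/-- **Theorem D — grouping the `G(k)`-sum by the fibres of any labelling** (the orbit labelling `G(k) → T(k)\G(k)/T′(k)`
is the intended one; any map does): if the folded orbital integrals are summable over `G(k)`, their sum is the sum over
the labels of the sums over the fibres (`HasSum.tsum_fiberwise`). -/
theorem tsum_orbitalc_eq_tsum_fibers {ι : Type} (f : GA W → ℂ) (lab : rationalPoints W → ι)
    (hs : Summable (fun γ : rationalPoints W => R.orbitalc (γ : GA W) f)) :
    (∑' γ : rationalPoints W, R.orbitalc (γ : GA W) f) =
      ∑' c : ι, ∑' γ : lab ⁻¹' {c}, R.orbitalc ((γ : rationalPoints W) : GA W) f :=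
  (hs.hasSum.tsum_fiberwise lab).tsum_eq.symm

/-- **The geometric side, assembled (Theorems A + D + C + B)**: under the displayed convergence hypotheses, the DEFINED
double period `Jc f` is the sum over the labels of the orbit sums, and a regular orbit `{δ⁻¹ γ₀ δ′}` that is exactly
the fibre of its label contributes the single UNFOLDED orbital integral `O_{γ₀}(f)` over `T(𝔸) × T′(𝔸)`. -/
theorem orbit_term_eq_orbitalFull [MeasurableMul (torusT W)] [MeasurableMul (torusT' W)] (hR : R.IsHaar)
    {ι : Type} (f : GA W → ℂ) (lab : rationalPoints W → ι) (γ₀ : rationalPoints W) (c : ι)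
    (hfib : lab ⁻¹' {c} = Set.range (orbitMap W γ₀)) (hinj : Function.Injective (orbitMap W γ₀))
    (hs : Summable (fun p : rationalOf W (torusT W) × rationalOf W (torusT' W) =>
      R.orbitalc ((orbitMap W γ₀ p : rationalPoints W) : GA W) f))
    (hB1 : Integrable (fun t : torusT W => R.chi t * innerFull W R f (γ₀ : GA W) t) R.μT)
    (hB2 : ∀ s : torusT W, Integrable (innerFn W R f (γ₀ : GA W) s) R.μT')
    (hB3 : ∀ (δ : rationalOf W (torusT W)) (δ' : rationalOf W (torusT' W)),
      Integrable (fun t : torusT W =>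
        R.chi t * innerInt W R f (((δ : torusT W) : GA W)⁻¹ * (γ₀ : GA W) * ((δ' : torusT' W) : GA W)) t)
        (R.μT.restrict R.DT))
    (hB4 : ∀ δ : rationalOf W (torusT W), Summable (fun δ' : rationalOf W (torusT' W) =>
      ∫ t in R.DT, ‖R.chi t * innerInt W R f (((δ : torusT W) : GA W)⁻¹ * (γ₀ : GA W) * ((δ' : torusT' W) : GA W)) t‖
        ∂(R.μT))) :
    (∑' γ : lab ⁻¹' {c}, R.orbitalc ((γ : rationalPoints W) : GA W) f) = orbitalFull W R f (γ₀ : GA W) := by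
  rw [tsum_congr_set_coe (fun γ : rationalPoints W => R.orbitalc (γ : GA W) f) hfib,
    tsum_orbit_eq_tsum_tsum W R f γ₀ hinj hs, orbitalFull_eq_tsum_tsum W R hR f (γ₀ : GA W) hB1 hB2 hB3 hB4]

/-- **W5's shape «only one orbit contributes» (Feigon–Whitehouse 2009 p. 5 for one torus at large level)**: if every
orbit term other than that of the label `c₀` vanishes, and the fibre of `c₀` is the regular orbit of `γ₀`, then the
DEFINED double period `Jc f` IS the single unfolded orbital integral `O_{γ₀}(f)` — so W5 (`Jc f ≠ 0`) is exactly
`O_{γ₀}(f) ≠ 0` under these displayed hypotheses (A0)–(A4), (B1)–(B4), summability over `G(k)`, and the isolation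
`hiso` (the arithmetic input: at deep level no other rational double coset meets the support of `f`). -/
theorem Jc_eq_orbitalFull_of_isolated [MeasurableMul (torusT W)] [MeasurableMul (torusT' W)] (hR : R.IsHaar)
    {ι : Type} (f : GA W → ℂ) (lab : rationalPoints W → ι) (γ₀ : rationalPoints W) (c₀ : ι)
    (hA0 : ∀ t : torusT W, Integrable (fun t' : torusT' W => R.chi'conj t' * kernel W f (t : GA W) (t' : GA W))
      (R.μT'.restrict R.DT'))
    (hA0' : Integrable (fun t : torusT W => R.chi t *
      ∫ t' in R.DT', R.chi'conj t' * kernel W f (t : GA W) (t' : GA W) ∂(R.μT')) (R.μT.restrict R.DT))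
    (hA1 : ∀ (γ : rationalPoints W) (t : torusT W),
      Integrable (innerFn W R f (γ : GA W) t) (R.μT'.restrict R.DT'))
    (hA2 : ∀ t : torusT W, Summable (fun γ : rationalPoints W =>
      ∫ t' in R.DT', ‖innerFn W R f (γ : GA W) t t'‖ ∂(R.μT')))
    (hA3 : ∀ γ : rationalPoints W,
      Integrable (fun t : torusT W => R.chi t * innerInt W R f (γ : GA W) t) (R.μT.restrict R.DT))
    (hA4 : Summable (fun γ : rationalPoints W =>
      ∫ t in R.DT, ‖R.chi t * innerInt W R f (γ : GA W) t‖ ∂(R.μT)))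
    (hsΓ : Summable (fun γ : rationalPoints W => R.orbitalc (γ : GA W) f))
    (hiso : ∀ c, c ≠ c₀ → (∑' γ : lab ⁻¹' {c}, R.orbitalc ((γ : rationalPoints W) : GA W) f) = 0)
    (hfib : lab ⁻¹' {c₀} = Set.range (orbitMap W γ₀)) (hinj : Function.Injective (orbitMap W γ₀))
    (hB1 : Integrable (fun t : torusT W => R.chi t * innerFull W R f (γ₀ : GA W) t) R.μT)
    (hB2 : ∀ s : torusT W, Integrable (innerFn W R f (γ₀ : GA W) s) R.μT')
    (hB3 : ∀ (δ : rationalOf W (torusT W)) (δ' : rationalOf W (torusT' W)),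
      Integrable (fun t : torusT W =>
        R.chi t * innerInt W R f (((δ : torusT W) : GA W)⁻¹ * (γ₀ : GA W) * ((δ' : torusT' W) : GA W)) t)
        (R.μT.restrict R.DT))
    (hB4 : ∀ δ : rationalOf W (torusT W), Summable (fun δ' : rationalOf W (torusT' W) =>
      ∫ t in R.DT, ‖R.chi t * innerInt W R f (((δ : torusT W) : GA W)⁻¹ * (γ₀ : GA W) * ((δ' : torusT' W) : GA W)) t‖
        ∂(R.μT))) :
    R.Jc f = orbitalFull W R f (γ₀ : GA W) := by
  have hs : Summable (fun p : rationalOf W (torusT W) × rationalOf W (torusT' W) =>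
      R.orbitalc ((orbitMap W γ₀ p : rationalPoints W) : GA W) f) :=
    hsΓ.comp_injective hinj
  rw [Jc_eq_tsum_orbitalc W R f hA0 hA0' hA1 hA2 hA3 hA4, tsum_orbitalc_eq_tsum_fibers W R f lab hsΓ,
    tsum_eq_single c₀ hiso, orbit_term_eq_orbitalFull W R hR f lab γ₀ c₀ hfib hinj hs hB1 hB2 hB3 hB4]

end TheoremsCD

end Summit.Ventures.HodgeRepro.Tier4.Line4

end
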